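import Literature.MathematicalPhysics.QuantumFieldTheory.BalabanImbrieJaffe1984to88.BIJ88TrainTermBound307
import Literature.MathematicalPhysics.QuantumFieldTheory.BalabanImbrieJaffe1984to88.BIJ88CubeProductDset306
import Literature.MathematicalPhysics.QuantumFieldTheory.BalabanImbrieJaffe1984to88.BIJ88GaussShellInterpolated309

/-!
# `BalabanImbrieJaffe1984to88.BIJ88TermShellBound309` — T. Bałaban, J. Imbrie, A. Jaffe, *Effective action and cluster properties of the
abelian Higgs model*, Commun. Math. Phys. **114** (1988) 257–315 [BalabanImbrieJaffe1988]: p. 307 [PDF 51] L5–11 (Sect. 5.13: *"Functional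
derivatives hitting χ-factors farther than ½r(e_k) from Λ₁₀^{(k)c} produce factors e^{−cp(e_k)²} after integrating with respect to A^{(k)″},
φ^{(k)″}. These derivatives are supported at |A^{(k)″}| ≥ cp(e_k) or |φ^{(k)″}| ≥ cp(e_k) … Thus we can use the arguments at the end of Sect. 14
in [3] to extract the factors e^{−cp(e_k)²} from the Gaussian measure"*) and p. 309 [PDF 53] L21–28 ((5.14.4): *"Each t-derivative of a χ-factor
in χ′_{Λ₁₂^{(k)},t} gives at least a factor e^β(L^kε/ε₀)^{1/4−α} … the n-th derivative in t of χ(cp(e_k), A^{(k)}) is bounded by t^{−n} times a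
function bounded by a constant and supported in c₁p(te_k) ≦ |A^{(k)}| ≦ c₂p(te_k). After integration over A^{(k)}, we obtain factors
ct^{−n}e^{−cp(te_k)²}"*) — **ONE TRAIN EXPECTATION OF THE WALK FORM: THE END-DATA SUM OF |TRAIN COEFFICIENT| × (PRODUCT OF CUBE COSTS),
TIMES ONE GAUSSIAN SHELL FACTOR PER `t`-DIFFERENTIATED χ-SLOT**.

The estimate E4c of the §f assembly, for GENERIC cube-local `C_b^∞` factors `f(□_i)` whose iterated coordinate derivatives on the fields of `X`
obey CUBE COSTS WITH A KEPT EVENT, `|∂_{q_{D}}[f(□_i)∘ext](φ)| ≤ C_i(q,D)·1_{S_i}(φ)` (for the located derivative observables of p. 308 this is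
`BIJ88CubeSlotCosts309.abs_dset_fD_uD_ext_le_indicator`, `S_i` = the joint shell of the `t`-differentiated χ-slots of `□_i`):
* §1 `abs_dset_obs_le_prod_mul_indicator` — a coordinate derivative of the cube product `Π_{□_i⊂X} f(□_i)` is the product over the cubes of the
  derivatives of the factors by the legs landing there (`BIJ88CubeProductDset306.dset_obs_eq_prod`), hence `≤ (Π_i C_i)·1_{⋂_i S_i}`;
* §2 **`abs_trains_apply_le_indicator`** — a product of trains applied to the cube product is the end-data sum `Σ_E trainCoef_E·∂_{legs E}`
  (`BIJ88TrainsDsetExpansion306.trains_apply_eq_sum_dset`), hence `≤ (Σ_E |trainCoef_E|·Π_i C_i(E))·1_{⋂_i S_i}` — the joint event survives the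
  sum because it does not depend on the end data (`BIJ88TrainTermBound307.abs_sum_le_sum_mul_indicator`);
* §3 **`abs_gexp_trains_obs_le`** — if the joint event lies in the shell event `{a_b ≤ |Φ_b(ext ω)| ∀ b ∈ B′}` of linear slot fields, the
  interpolated expectation `⟨(Π_{c∈P}𝕋_c) Π f(□_i)⟩_{s,X}` is at most `(Σ_E |trainCoef_E|·Π_i C_i(E)) · Π_{b∈B′} 2e^{−a_b(a_b−2ΛF/m)/(2Λ²/m)}`,
  uniformly in `s ∈ [0,1]^I` (`BIJ88GaussShellInterpolated309.abs_gexp_prec_le_shell`) — the bound `B(σ,P)` that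
  `BIJ88ActivityWalkBound309.abs_actIn_le_sum` sums over vertex structures and trains.

statement-level skeleton of published theorems with citation tags; proofs where landed; nothing here is a claim about the Yang–Mills mass gap

PDF held: `paper:balaban1988-cmp114-bij-abelian-higgs-effective-action` (journal page = PDF page + 256); pages re-read this session as text:
PDF 51 (p. 307) L2–20, PDF 53 (p. 309) L12–28.

CITATION HEADER (lean-in-tree rule).  Part of the lit-balaban TYPED SKELETON (HOME `run/shared/lean/pub/lit-balaban/`), Phase 2, seat p36
(gen 22, unit `lit-balaban-p36`); rows **C2.Eq5.14.3-5.14.4** (member: §f assembly estimate E4c — one train expectation) and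
C2.Eq5.13.3-5.13.4 (member) of `HOME/lit-balaban-r16/ROWS-C2-part2.md` (owner r16, referee ref-5).  Theorem-only; no definitions, no `Prop`
facts; axioms standard.
HONEST SCOPE.  The cube costs `C_i`, the events `S_i`, the frame letter `Λ`, the coercivity `m`, the source bound `F` and the thresholds `a_b`
are inputs; the train coefficients are NOT estimated here (their walk-kernel decay is `BIJ88WalkKernelDecay307` & co., their counting the
assembly's).  NOT summit progress; NOT continuum; NOT Clay.

REVISION (doc-only, referee/owner items N-ref1-g107-2 / N-ref1-g115-1 / D-owner-v2.389): the p. 307 L5–13 quotation above now carries print's region symbols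
`Λ₁₀^{(k)c}` / `Λ₁₁^{(k)}` and *"χ′-factors"* and the balanced «|A^{(k)}|»; no declaration changed.
-/

namespace Literature.MathematicalPhysics.QuantumFieldTheory.BalabanImbrieJaffe1984to88.BIJ88TermShellBound309

open Finset Matrix
open scoped BigOperators
open BIJ88WickSourceSmooth305 (dset)
open BIJ88SmoothFactors5133 (CbInf)
open BIJ88TrainPieces306 (wker)
open BIJ88WalkForm5133 (trains)
open BIJ88TrainsDsetExpansion306 (trainCoef trainLegs trainSite trains_apply_eq_sum_dset)
open BIJ88TrainTermBound307 (abs_prod_le_prod_mul_prod prod_indicator_one_eq_indicator_iInter abs_sum_le_sum_mul_indicator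
  mul_indicator_le_mul_indicator_of_subset)
open BIJ88CubeProductDset306 (dset_obs_eq_prod)
open BIJ88PolymerRep5134Gauss (obs prec src ext)
open BIJ88TruncationConnected306 (gexp)
open BIJ88GaussShellInterpolated309 (abs_gexp_prec_le_shell)

variable {α I : Type} [Fintype α] [DecidableEq α] [Fintype I] [DecidableEq I] (blk : α → I) (Δ : Matrix α α ℝ) (ℱ : α → ℝ)
  (f : I → (α → ℝ) → ℝ) (X : Finset I)

/-! ## §1  One coordinate derivative of the cube product: product of cube costs, joint event kept -/

omit [Fintype I] in
/-- **`|∂_{q_D}[Π_{□_i⊂X} f(□_i)](φ)| ≤ (Π_{i∈X} C_i(D_i)) · 1_{⋂_{i∈X} S_i}(φ)`**, `D_i = {j ∈ D : blk q_j = i}`, from cube costs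
`|∂_{q_{D′}}[f(□_i)∘ext](φ)| ≤ C_i(D′)·1_{S_i}(φ)` for cube-local `C_b^∞` factors (each leg lands on the cube of its site,
`BIJ88CubeProductDset306.dset_obs_eq_prod`; a product of indicators is the indicator of the intersection).
[cite: BalabanImbrieJaffe1988, §5.13 p.307, (5.14.4) p.309] -/
theorem abs_dset_obs_le_prod_mul_indicator {κ : Type} [LinearOrder κ] [Fintype κ] (hf : ∀ i ∈ X, CbInf (f i))
    (hloc : ∀ i ∈ X, ∀ φ ψ : α → ℝ, (∀ x, blk x = i → φ x = ψ x) → f i φ = f i ψ) (i₀ : I)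
    (q : κ → BIJ88PolymerRep5134Gauss.Site blk X) {Cc : I → Finset κ → ℝ}
    (Sh : I → Set (BIJ88PolymerRep5134Gauss.Site blk X → ℝ))
    (hcube : ∀ i ∈ X, ∀ (D' : Finset κ) (φ : BIJ88PolymerRep5134Gauss.Site blk X → ℝ),
      |dset (fun j => Pi.single (q j) (1 : ℝ)) D' (fun ψ => f i (ext blk X ψ)) φ| ≤ Cc i D' * (Sh i).indicator 1 φ)
    (D : Finset κ) (φ : BIJ88PolymerRep5134Gauss.Site blk X → ℝ) :
    |dset (fun j => Pi.single (q j) (1 : ℝ)) D (obs blk f X) φ| ≤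
      (∏ i ∈ X, Cc i (D.filter fun j => blk (q j).1 = i)) * (⋂ i ∈ X, Sh i).indicator (1 : (BIJ88PolymerRep5134Gauss.Site blk X → ℝ) → ℝ) φ := by
  rw [dset_obs_eq_prod blk f X hf hloc i₀ q D φ, ← prod_indicator_one_eq_indicator_iInter]
  exact abs_prod_le_prod_mul_prod X
    (a := fun i φ => dset (fun j => Pi.single (q j) (1 : ℝ)) (D.filter fun j => blk (q j).1 = i) (fun ψ => f i (ext blk X ψ)) φ)
    (w := fun i φ => (Sh i).indicator 1 φ) (c := fun i => Cc i (D.filter fun j => blk (q j).1 = i))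
    (fun i hi φ => hcube i hi _ φ) φ

/-! ## §2  A product of trains applied to the cube product -/

omit [Fintype I] in
/-- **`|(Π_k 𝕋_{c_k}) Π_{□_i⊂X} f(□_i) (φ)| ≤ (Σ_E |trainCoef_E| · Π_{i∈X} C_i(E)) · 1_{⋂_{i∈X} S_i}(φ)`**: the trains are the end-data sum
`Σ_E trainCoef_E · ∂_{legs(E)}` (`BIJ88TrainsDsetExpansion306.trains_apply_eq_sum_dset`), each derivative costs §1, and the joint event — which
does not depend on the end data — survives the sum (p. 309: every `t`-differentiated χ-slot keeps its shell *whatever the functional derivatives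
do*; p. 307: *"(Factorials can be produced when many functional derivatives hit the same object …)"* — they sit in the `C_i(E)`).
[cite: BalabanImbrieJaffe1988, §5.13 Eq. (5.13.3) p.306, p.307, (5.14.4) p.309] -/
theorem abs_trains_apply_le_indicator (hf : ∀ i ∈ X, CbInf (f i))
    (hloc : ∀ i ∈ X, ∀ φ ψ : α → ℝ, (∀ x, blk x = i → φ x = ψ x) → f i φ = f i ψ) (i₀ : I)
    (fsrc : BIJ88PolymerRep5134Gauss.Site blk X → ℝ)
    (C : Matrix (BIJ88PolymerRep5134Gauss.Site blk X) (BIJ88PolymerRep5134Gauss.Site blk X) ℝ)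
    (N : Finset I → Matrix (BIJ88PolymerRep5134Gauss.Site blk X) (BIJ88PolymerRep5134Gauss.Site blk X) ℝ)
    (L : List (Finset (Finset I)))
    {Cc : (Fin L.length ×ₗ Fin 2 → BIJ88PolymerRep5134Gauss.Site blk X) → I → Finset (Fin L.length ×ₗ Fin 2) → ℝ}
    (Sh : I → Set (BIJ88PolymerRep5134Gauss.Site blk X → ℝ))
    (hcube : ∀ (q : Fin L.length ×ₗ Fin 2 → BIJ88PolymerRep5134Gauss.Site blk X), ∀ i ∈ X,
      ∀ (D' : Finset (Fin L.length ×ₗ Fin 2)) (φ : BIJ88PolymerRep5134Gauss.Site blk X → ℝ),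
      |dset (fun j => Pi.single (q j) (1 : ℝ)) D' (fun ψ => f i (ext blk X ψ)) φ| ≤ Cc q i D' * (Sh i).indicator 1 φ)
    (φ : BIJ88PolymerRep5134Gauss.Site blk X → ℝ) :
    |trains fsrc C N L (obs blk f X) φ| ≤
      (∑ E : Fin L.length → BIJ88PolymerRep5134Gauss.Site blk X ⊕
          (BIJ88PolymerRep5134Gauss.Site blk X × BIJ88PolymerRep5134Gauss.Site blk X),
        |trainCoef fsrc (fun k => C * wker C N (L.get k)) E| *
          ∏ i ∈ X, Cc (trainSite E) i ((trainLegs E).filter fun j => blk (trainSite E j).1 = i)) *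
        (⋂ i ∈ X, Sh i).indicator (1 : (BIJ88PolymerRep5134Gauss.Site blk X → ℝ) → ℝ) φ := by
  rw [trains_apply_eq_sum_dset fsrc C N (CbInf.obs blk f X hf) L φ]
  refine abs_sum_le_sum_mul_indicator univ
    (t := fun E φ => trainCoef fsrc (fun k => C * wker C N (L.get k)) E *
      dset (fun j => Pi.single (trainSite E j) (1 : ℝ)) (trainLegs E) (obs blk f X) φ)
    (M := fun E => |trainCoef fsrc (fun k => C * wker C N (L.get k)) E| *
      ∏ i ∈ X, Cc (trainSite E) i ((trainLegs E).filter fun j => blk (trainSite E j).1 = i))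
    (⋂ i ∈ X, Sh i) (fun E _ φ => ?_) φ
  rw [abs_mul, mul_assoc]
  exact mul_le_mul_of_nonneg_left
    (abs_dset_obs_le_prod_mul_indicator blk f X hf hloc i₀ (trainSite E) Sh (hcube (trainSite E)) (trainLegs E) φ) (abs_nonneg _)

/-! ## §3  Gaussian integration at interpolated `s`: one shell factor per `t`-differentiated χ-slot -/

variable {ι : Type*} (B' : Finset ι) {Φ : ι → (α → ℝ) → ℝ}

/-- **ONE TRAIN EXPECTATION**: for `Δ ≻ 0` with `Δ ≥ m > 0`, `s ∈ [0,1]^I`, linear slot fields `Φ_b` (`b ∈ B′`) with the frame letter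
`|Σ_bθ_bΦ_b(φ)| ≤ Λ‖θ‖₂‖φ‖₂`, source `‖ℱ|_X‖₂ ≤ F`, thresholds `a_b ≥ 0`, cube-local `C_b^∞` factors with cube costs `C_i ≥ 0` and events `S_i`
whose intersection lies in the shell event `{a_b ≤ |Φ_b(ext ω)| ∀ b ∈ B′}`:
`|⟨(Π_k 𝕋_{c_k}) Π_{□_i⊂X} f(□_i)⟩_{s,X}| ≤ (Σ_E |trainCoef_E|·Π_{i∈X} C_i(E)) · Π_{b∈B′} 2e^{−a_b(a_b − 2ΛF/m)/(2Λ²/m)}`,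
the trains built on `C_s = (prec X s)⁻¹` and any vertex matrices `N_b` (p. 307: the shell factors *"e^{−cp(e_k)²}"* extracted *"from the
Gaussian measure"*; p. 309: *"After integration over A^{(k)}, we obtain factors ct^{−n}e^{−cp(te_k)²}"*).
[cite: BalabanImbrieJaffe1988, §5.13 p.307, (5.14.4) p.309] -/
theorem abs_gexp_trains_obs_le [DecidableEq ι] (hΔ : Δ.PosDef) {m : ℝ} (hm : 0 < m)
    (hΔm : ∀ φ : α → ℝ, m * (φ ⬝ᵥ φ) ≤ φ ⬝ᵥ (Δ *ᵥ φ)) {s : I → ℝ} (hs : ∀ i, 0 ≤ s i ∧ s i ≤ 1)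
    (hlin : ∀ b ∈ B', IsLinearMap ℝ (Φ b)) {Λ : ℝ} (hΛ : 0 < Λ)
    (hframe : ∀ (θ : ↥B' → ℝ) (φ : α → ℝ), |∑ b : ↥B', θ b * Φ b φ| ≤ Λ * Real.sqrt (∑ b : ↥B', θ b ^ 2) * Real.sqrt (φ ⬝ᵥ φ))
    {F : ℝ} (hF0 : 0 ≤ F) (hF : src blk ℱ X ⬝ᵥ src blk ℱ X ≤ F ^ 2) {a : ↥B' → ℝ} (ha : ∀ b, 0 ≤ a b)
    (hf : ∀ i ∈ X, CbInf (f i)) (hloc : ∀ i ∈ X, ∀ φ ψ : α → ℝ, (∀ x, blk x = i → φ x = ψ x) → f i φ = f i ψ) (i₀ : I)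
    (N : Finset I → Matrix (BIJ88PolymerRep5134Gauss.Site blk X) (BIJ88PolymerRep5134Gauss.Site blk X) ℝ)
    (L : List (Finset (Finset I)))
    {Cc : (Fin L.length ×ₗ Fin 2 → BIJ88PolymerRep5134Gauss.Site blk X) → I → Finset (Fin L.length ×ₗ Fin 2) → ℝ}
    (hCc : ∀ q, ∀ i ∈ X, ∀ D', 0 ≤ Cc q i D') (Sh : I → Set (BIJ88PolymerRep5134Gauss.Site blk X → ℝ))
    (hcube : ∀ (q : Fin L.length ×ₗ Fin 2 → BIJ88PolymerRep5134Gauss.Site blk X), ∀ i ∈ X,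
      ∀ (D' : Finset (Fin L.length ×ₗ Fin 2)) (φ : BIJ88PolymerRep5134Gauss.Site blk X → ℝ),
      |dset (fun j => Pi.single (q j) (1 : ℝ)) D' (fun ψ => f i (ext blk X ψ)) φ| ≤ Cc q i D' * (Sh i).indicator 1 φ)
    (hSh : ∀ φ : BIJ88PolymerRep5134Gauss.Site blk X → ℝ, (φ ∈ ⋂ i ∈ X, Sh i) → ∀ b : ↥B', a b ≤ |Φ b (ext blk X φ)|) :
    |gexp (prec blk Δ X s) (src blk ℱ X)
        (trains (src blk ℱ X) (prec blk Δ X s)⁻¹ N L (obs blk f X))| ≤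
      (∑ E : Fin L.length → BIJ88PolymerRep5134Gauss.Site blk X ⊕
          (BIJ88PolymerRep5134Gauss.Site blk X × BIJ88PolymerRep5134Gauss.Site blk X),
        |trainCoef (src blk ℱ X) (fun k => (prec blk Δ X s)⁻¹ * wker (prec blk Δ X s)⁻¹ N (L.get k)) E| *
          ∏ i ∈ X, Cc (trainSite E) i ((trainLegs E).filter fun j => blk (trainSite E j).1 = i)) *
        ∏ b : ↥B', 2 * Real.exp (-(a b * (a b - 2 * (Λ * F / m)) / (2 * (Λ ^ 2 / m)))) := by
  have hM : 0 ≤ ∑ E : Fin L.length → BIJ88PolymerRep5134Gauss.Site blk X ⊕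
        (BIJ88PolymerRep5134Gauss.Site blk X × BIJ88PolymerRep5134Gauss.Site blk X),
      |trainCoef (src blk ℱ X) (fun k => (prec blk Δ X s)⁻¹ * wker (prec blk Δ X s)⁻¹ N (L.get k)) E| *
        ∏ i ∈ X, Cc (trainSite E) i ((trainLegs E).filter fun j => blk (trainSite E j).1 = i) :=
    sum_nonneg fun E _ => mul_nonneg (abs_nonneg _) (prod_nonneg fun i hi => hCc _ i hi _)
  refine abs_gexp_prec_le_shell blk Δ ℱ B' hΔ hm hΔm hs X hlin hΛ hframe hF0 hF ha hM fun ω => ?_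
  exact (abs_trains_apply_le_indicator blk f X hf hloc i₀ (src blk ℱ X) (prec blk Δ X s)⁻¹ N L Sh hcube ω).trans
    (mul_indicator_le_mul_indicator_of_subset (fun φ hφ => hSh φ hφ) hM ω)

end Literature.MathematicalPhysics.QuantumFieldTheory.BalabanImbrieJaffe1984to88.BIJ88TermShellBound309
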